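import Literature.NumberTheory.Automorphic.GLTwoTorusVolume
import Literature.NumberTheory.Automorphic.AdelicUnitsCongr
import Literature.NumberTheory.Automorphic.QuaternionGLTwoClasses
import HarnessLib

/-!
# The tori of matching classes of `D^×` and `GL(2)` are isomorphic, with equal volume factors
(Gelbart, *Automorphic forms on adele groups* (1975), p. 155: in the comparison of (10.14) and
(10.15), "`meas(Z'_𝔸 B'_F \ B'_𝔸) = meas(Z_𝔸 B_F \ B_𝔸)`" — `B' = B'(E) ≤ G' = D^×` and
`B = B(E) ≤ G = GL(2)` being the centralisers of one quadratic extension `E`; Jacquet–Langlands,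
LNM 114, §16)

Topic `NumberTheory/Automorphic`. Definition (`quaternionGlTwoCentralizerAdelicEquiv`) and
theorems; no named fact, no instance. Assembly of

* `QuaternionTorusCentralizer.unitsTorusEquiv : T_𝔸ˣ ≃ₜ* C_{D_𝔸ˣ}(γ')`, `T = C_D(γ') = K(γ')`
  (carrying `ℝ_{>0} Tˣ` onto `ℝ_{>0} Dˣ ∩ C(γ')`),
* `QuaternionGLTwoClasses.quaternionGlTwoCentralizerEquiv : T ≃ₐ[K] E`, `E = C_{M₂(K)}(γ) = K(γ)`,
  for `(trd, nrd)(γ') = (tr, det)(γ)` with `γ` elliptic, and its adelic points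
  `AdelicUnitsCongr.unitsCongr : T_𝔸ˣ ≃ₜ* E_𝔸ˣ` (carrying `ℝ_{>0} Tˣ` onto `ℝ_{>0} Eˣ`),
* `GLTwoAdelicTorus.glTwoDatumTorusEquiv : E_𝔸ˣ ≃ₜ* C_{GL₂(𝔸_K)}(γ)` (carrying `ℝ_{>0} Eˣ` onto
  `ℝ_{>0} GL₂(K) ∩ C(γ)`),

into

* `quaternionGlTwoCentralizerAdelicEquiv` — **`C_{D_𝔸ˣ}(γ') ≃ₜ* C_{GL₂(𝔸_K)}(γ)` for a regular
  `γ' ∈ Dˣ` (`D` division) and an elliptic `γ ∈ GL₂(K)` with `trd γ' = tr γ`, `nrd γ' = det γ`**,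
  with `quaternionGlTwoCentralizerAdelicEquiv_mem_iff`: it carries `ℝ_{>0} Dˣ ∩ C(γ')` onto
  `ℝ_{>0} GL₂(K) ∩ C(γ)`;
* `quaternion_glTwo_volumeFactor_eq` — **equality of the volume factors of the two trace
  formulas at matching classes**: for Haar-type measures corresponding under this isomorphism,
  `vol(C(γ') ⧸ (ℝ_{>0} Dˣ ∩ C(γ')); ν', ρ') = vol(C(γ) ⧸ (ℝ_{>0} GL₂(K) ∩ C(γ)); ν, ρ)` — the total
  masses of the quotient measures with Weil constant one (`quotientMeasure_univ_eq_of_mulEquiv`),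
  i.e. the factors `meas(Z'_𝔸 B'_F \ B'_𝔸)` of (10.14) (`QuaternionUnitsTraceNormalized`) and
  `meas(Z_𝔸 B_F \ B_𝔸)` of (10.15); with the non-vacuity `quaternion_glTwo_exists_measures` and the
  instance binders discharged by `quaternion_glTwo_volumeFactor_hypotheses`.

A brick of the inline (D-0026) decomposition of
`Literature.NumberTheory.Automorphic.strong_multiplicity_one_quaternionUnits` (Gelbart Thm. 10.5):
term-by-term comparison of the elliptic parts of (10.14) and (10.15).

## References

* S. Gelbart, *Automorphic forms on adele groups*, Ann. of Math. Studies 83 (1975), pp. 154–155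
  [Gelbart1975].
* H. Jacquet, R. P. Langlands, *Automorphic forms on GL(2)*, LNM 114 (1970), §16
  [JacquetLanglands1970].
-/

noncomputable section

open scoped TensorProduct NNReal ENNReal
open NumberField IsDedekindDomain MeasureTheory Measure Topology Matrix
open Literature.MeasureTheory.Group

namespace Literature.NumberTheory.Automorphic

-- the coset spaces carry Borel σ-algebras supplied locally, not the quotient σ-algebra
attribute [-instance] Quotient.instMeasurableSpace QuotientGroup.measurableSpace

section Comparison

universe u

/- `D : Type u` is universe-polymorphic (as in `strong_multiplicity_one_quaternionUnits`), while
`GL₂(𝔸_K) = (AdelicGroupData.gl 2 K).Adelic` and the torus `E = K(γ) ≤ M₂(K)` live in `Type`; the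
model isomorphisms `unitsMapRight`/`unitsCongr` relate algebras in two universes
(`QuaternionAdelicTorus`, `AdelicUnitsCongr`, v2). In every declaration below `hD` says that `D` is
a division algebra, `γ ∈ GL₂(K)` is elliptic (`hγ`) and `(trd, nrd)(γ') = (tr, det)(γ)` (`ht`, `hn`);
the explicit arguments are `K D γ' γ hD hγ ht hn`. -/
variable (K : Type) [Field K] [NumberField K] (D : Type u) [Ring D] [Algebra K D] [IsQuaternionAlgebra K D]
  (γ' : Dˣ) (γ : GL (Fin 2) K)

/-- The adelic group datum of `D^×`. -/
local notation "GD" => AdelicGroupData.units K D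
/-- The adelic group datum of `GL₂`. -/
local notation "G2" => AdelicGroupData.gl 2 K
/-- `T = C_D(γ')`, the quadratic field of `γ'`. -/
local notation "Tγ" => Subalgebra.centralizer K ({((γ' : Dˣ) : D)} : Set D)
/-- `E = C_{M₂(K)}(γ)`, the quadratic field of `γ`. -/
local notation "Eγ" => Subalgebra.centralizer K ({((γ : GL (Fin 2) K) : Matrix (Fin 2) (Fin 2) K)} :
  Set (Matrix (Fin 2) (Fin 2) K))
/-- `C(γ') ≤ D_𝔸ˣ` (spelled `AdelicGroupData.toAdelic GD γ'`, i.e. `(GD).toAdelic γ'`). -/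
local notation "Cq" => Subgroup.centralizer ({AdelicGroupData.toAdelic (AdelicGroupData.units K D) γ'} :
  Set (AdelicGroupData.Adelic (AdelicGroupData.units K D)))
/-- `C(γ) ≤ GL₂(𝔸_K)` (spelled `AdelicGroupData.toAdelic G2 γ`). -/
local notation "Cg" => Subgroup.centralizer ({AdelicGroupData.toAdelic (AdelicGroupData.gl 2 K) γ} :
  Set (AdelicGroupData.Adelic (AdelicGroupData.gl 2 K)))

/-- A quaternion unit matching an elliptic `γ` is regular (`γ' ∉ K`). [folklore] -/
theorem units_not_mem_bot_of_trace_det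
    (hγ : Irreducible (γ : Matrix (Fin 2) (Fin 2) K).charpoly)
    (ht : reducedTrace K D (γ' : D) = (γ : Matrix (Fin 2) (Fin 2) K).trace)
    (hn : reducedNorm K D (γ' : D) = (γ : Matrix (Fin 2) (Fin 2) K).det) :
    ((γ' : Dˣ) : D) ∉ (⊥ : Subalgebra K D) :=
  not_mem_bot_of_trace_det K D hγ ht hn

/-- **The adelic tori of matching classes are isomorphic: `C_{D_𝔸ˣ}(γ') ≃ₜ* C_{GL₂(𝔸_K)}(γ)`** for a
division quaternion algebra `D` over the number field `K`, `γ' ∈ Dˣ` and an elliptic `γ ∈ GL₂(K)`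
with `trd γ' = tr γ`, `nrd γ' = det γ`: the composite
`C(γ') ≃ T_𝔸ˣ ≃ E_𝔸ˣ ≃ C(γ)` of `unitsTorusEquiv⁻¹`, `unitsCongr (T ≃ₐ E)` and `glTwoDatumTorusEquiv`
(Gelbart (1975), p. 155: `B'_𝔸 ≅ B_𝔸`, both the idele group of `E`). [cite: Gelbart1975, pp. 154–155] -/
def quaternionGlTwoCentralizerAdelicEquiv (hD : ∀ x : D, x ≠ 0 → IsUnit x)
    (hγ : Irreducible (γ : Matrix (Fin 2) (Fin 2) K).charpoly)
    (ht : reducedTrace K D (γ' : D) = (γ : Matrix (Fin 2) (Fin 2) K).trace)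
    (hn : reducedNorm K D (γ' : D) = (γ : Matrix (Fin 2) (Fin 2) K).det) : Cq ≃ₜ* Cg :=
  ((unitsTorusEquiv K D hD γ' (units_not_mem_bot_of_trace_det K D γ' γ hγ ht hn)).symm.trans
    (AdelicGroupData.unitsCongr K
      (quaternionGlTwoCentralizerEquiv K D hD (γ' : D) (γ : Matrix (Fin 2) (Fin 2) K) hγ ht hn))).trans
    (glTwoDatumTorusEquiv K γ (not_mem_bot_of_irreducible_charpoly hγ))

/-- **`quaternionGlTwoCentralizerAdelicEquiv` carries `ℝ_{>0} Dˣ ∩ C(γ')` onto `ℝ_{>0} GL₂(K) ∩ C(γ)`**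
(composition of `unitsTorusEquiv_mem_iff`, `unitsCongr_mem_quotientSubgroup_iff`,
`glTwoDatumTorusEquiv_mem_iff`): the subgroups `Z'_𝔸 B'_F`, `Z_𝔸 B_F` of Gelbart p. 155 correspond.
[cite: Gelbart1975, p. 155] -/
theorem quaternionGlTwoCentralizerAdelicEquiv_mem_iff (hD : ∀ x : D, x ≠ 0 → IsUnit x)
    (hγ : Irreducible (γ : Matrix (Fin 2) (Fin 2) K).charpoly)
    (ht : reducedTrace K D (γ' : D) = (γ : Matrix (Fin 2) (Fin 2) K).trace)
    (hn : reducedNorm K D (γ' : D) = (γ : Matrix (Fin 2) (Fin 2) K).det) (g : Cq) :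
    quaternionGlTwoCentralizerAdelicEquiv K D γ' γ hD hγ ht hn g ∈
        (((G2).quotientSubgroup ⊓ Cg).subgroupOf Cg) ↔
      g ∈ (((GD).quotientSubgroup ⊓ Cq).subgroupOf Cq) := by
  have hγ' := units_not_mem_bot_of_trace_det K D γ' γ hγ ht hn
  set eT := unitsTorusEquiv K D hD γ' hγ' with heT
  set eA := AdelicGroupData.unitsCongr K
    (quaternionGlTwoCentralizerEquiv K D hD (γ' : D) (γ : Matrix (Fin 2) (Fin 2) K) hγ ht hn) with heA
  set eE := glTwoDatumTorusEquiv K γ (not_mem_bot_of_irreducible_charpoly hγ) with heE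
  change eE (eA (eT.symm g)) ∈ _ ↔ _
  rw [glTwoDatumTorusEquiv_mem_iff, AdelicGroupData.unitsCongr_mem_quotientSubgroup_iff,
    ← unitsTorusEquiv_mem_iff K D hD γ' hγ' (eT.symm g)]
  change eT (eT.symm g) ∈ _ ↔ _
  rw [eT.apply_symm_apply]

attribute [local instance] AdelicGroupData.measurableSpaceQuotientForm
  AdelicGroupData.borelSpaceQuotientForm

/-- **The volume factors of matching classes agree** (Gelbart (1975), p. 155:
"`meas(Z'_𝔸 B'_F \ B'_𝔸) = meas(Z_𝔸 B_F \ B_𝔸)`"). Let `D` be a division quaternion algebra over the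
number field `K`, `γ' ∈ Dˣ`, `γ ∈ GL₂(K)` elliptic with `trd γ' = tr γ`, `nrd γ' = det γ`,
`C' = C_{D_𝔸ˣ}(γ')`, `H' = ℝ_{>0} Dˣ ∩ C'`, `C = C_{GL₂(𝔸_K)}(γ)`, `H = ℝ_{>0} GL₂(K) ∩ C`, and
`Ψ = quaternionGlTwoCentralizerAdelicEquiv : C' ≃ₜ* C` (carrying `H'` onto `H`). If the Haar-type
measures correspond under `Ψ` — `ν = Ψ_* ν'` on `C`, `ρ = (Ψ|)_* ρ'` on `H` — then

  `vol(C ⧸ H; ν, ρ) = vol(C' ⧸ H'; ν', ρ')`,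

both being total masses of quotient measures with Weil constant one
(`quotientMeasure_univ_eq_of_mulEquiv`). The left side is the volume factor of the class of `γ`
in the elliptic term of (10.15), the right side that of the class of `γ'` in (10.14)
(`units_hasSum_norm_sq_integratedOperator_eq_tsum_covol_mul`). The instance binders hold by
`quaternion_glTwo_volumeFactor_hypotheses`. [cite: Gelbart1975, p. 155] -/
theorem quaternion_glTwo_volumeFactor_eq (hD : ∀ x : D, x ≠ 0 → IsUnit x)
    (hγ : Irreducible (γ : Matrix (Fin 2) (Fin 2) K).charpoly)
    (ht : reducedTrace K D (γ' : D) = (γ : Matrix (Fin 2) (Fin 2) K).trace)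
    (hn : reducedNorm K D (γ' : D) = (γ : Matrix (Fin 2) (Fin 2) K).det)
    [MeasurableSpace (G2).Adelic] [BorelSpace (G2).Adelic]
    [MeasurableSpace (GD).Adelic] [BorelSpace (GD).Adelic]
    [LocallyCompactSpace (G2).Adelic] [SecondCountableTopology (G2).Adelic] [T2Space (G2).Adelic]
    [LocallyCompactSpace (GD).Adelic] [SecondCountableTopology (GD).Adelic] [T2Space (GD).Adelic]
    [hH : IsClosed ((G2).quotientSubgroup : Set (G2).Adelic)]
    [hH' : IsClosed ((GD).quotientSubgroup : Set (GD).Adelic)]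
    [hC : IsClosed ((Cg : Subgroup (G2).Adelic) : Set (G2).Adelic)]
    [hC' : IsClosed ((Cq : Subgroup (GD).Adelic) : Set (GD).Adelic)]
    [MeasurableSpace (↥Cg ⧸ ((G2).quotientSubgroup ⊓ Cg).subgroupOf Cg)]
    [BorelSpace (↥Cg ⧸ ((G2).quotientSubgroup ⊓ Cg).subgroupOf Cg)]
    [MeasurableSpace (↥Cq ⧸ ((GD).quotientSubgroup ⊓ Cq).subgroupOf Cq)]
    [BorelSpace (↥Cq ⧸ ((GD).quotientSubgroup ⊓ Cq).subgroupOf Cq)]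
    (ν : Measure Cg) [IsHaarMeasure ν] [ν.IsMulRightInvariant]
    (ρ : Measure ↥(((G2).quotientSubgroup ⊓ Cg).subgroupOf Cg))
    [ρ.IsMulLeftInvariant] [IsFiniteMeasureOnCompacts ρ] [ρ.IsOpenPosMeasure] [ρ.IsInvInvariant] [SFinite ρ]
    (ν' : Measure Cq) [IsHaarMeasure ν'] [ν'.IsMulRightInvariant]
    (ρ' : Measure ↥(((GD).quotientSubgroup ⊓ Cq).subgroupOf Cq))
    [ρ'.IsMulLeftInvariant] [IsFiniteMeasureOnCompacts ρ'] [ρ'.IsOpenPosMeasure] [ρ'.IsInvInvariant]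
    [SFinite ρ']
    (hν : ν = Measure.map (quaternionGlTwoCentralizerAdelicEquiv K D γ' γ hD hγ ht hn) ν')
    (hρ : ρ = Measure.map (subgroupCongrHomeomorph
      (quaternionGlTwoCentralizerAdelicEquiv K D γ' γ hD hγ ht hn).toMulEquiv
      (((GD).quotientSubgroup ⊓ Cq).subgroupOf Cq) (((G2).quotientSubgroup ⊓ Cg).subgroupOf Cg)
      (quaternionGlTwoCentralizerAdelicEquiv_mem_iff K D γ' γ hD hγ ht hn)
      (quaternionGlTwoCentralizerAdelicEquiv K D γ' γ hD hγ ht hn).continuous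
      (quaternionGlTwoCentralizerAdelicEquiv K D γ' γ hD hγ ht hn).symm.continuous) ρ') :
    quotientMeasure (((G2).quotientSubgroup ⊓ Cg).subgroupOf Cg) ρ
        (isClosed_subgroupOf _ _ (hH.inter hC)) ν Set.univ =
      quotientMeasure (((GD).quotientSubgroup ⊓ Cq).subgroupOf Cq) ρ'
        (isClosed_subgroupOf _ _ (hH'.inter hC')) ν' Set.univ := by
  haveI : IsClosed (((((G2).quotientSubgroup ⊓ Cg).subgroupOf Cg) : Subgroup Cg) : Set Cg) :=
    isClosed_subgroupOf _ _ (hH.inter hC)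
  haveI : IsClosed (((((GD).quotientSubgroup ⊓ Cq).subgroupOf Cq) : Subgroup Cq) : Set Cq) :=
    isClosed_subgroupOf _ _ (hH'.inter hC')
  haveI : LocallyCompactSpace Cg := hC.isClosedEmbedding_subtypeVal.locallyCompactSpace
  haveI : LocallyCompactSpace Cq := hC'.isClosedEmbedding_subtypeVal.locallyCompactSpace
  exact quotientMeasure_univ_eq_of_mulEquiv (quaternionGlTwoCentralizerAdelicEquiv K D γ' γ hD hγ ht hn).toMulEquiv
    (quaternionGlTwoCentralizerAdelicEquiv K D γ' γ hD hγ ht hn).continuous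
    (quaternionGlTwoCentralizerAdelicEquiv K D γ' γ hD hγ ht hn).symm.continuous _ _
    (quaternionGlTwoCentralizerAdelicEquiv_mem_iff K D γ' γ hD hγ ht hn) ρ' ρ ν' ν hρ hν

/-- **The corresponding measures exist** (non-vacuity of `quaternion_glTwo_volumeFactor_eq`): the
pull-backs of `ν`, `ρ` along `Ψ` are Haar-type measures on `C(γ')`, `ℝ_{>0} Dˣ ∩ C(γ')` whose images
are `ν`, `ρ`. [folklore] -/
theorem quaternion_glTwo_exists_measures (hD : ∀ x : D, x ≠ 0 → IsUnit x)
    (hγ : Irreducible (γ : Matrix (Fin 2) (Fin 2) K).charpoly)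
    (ht : reducedTrace K D (γ' : D) = (γ : Matrix (Fin 2) (Fin 2) K).trace)
    (hn : reducedNorm K D (γ' : D) = (γ : Matrix (Fin 2) (Fin 2) K).det)
    [MeasurableSpace (G2).Adelic] [BorelSpace (G2).Adelic]
    [MeasurableSpace (GD).Adelic] [BorelSpace (GD).Adelic]
    (ν : Measure Cg) [IsHaarMeasure ν] [ν.IsMulRightInvariant]
    (ρ : Measure ↥(((G2).quotientSubgroup ⊓ Cg).subgroupOf Cg))
    [IsHaarMeasure ρ] [ρ.IsInvInvariant] [SFinite ρ] :
    ∃ (ν' : Measure Cq) (ρ' : Measure ↥(((GD).quotientSubgroup ⊓ Cq).subgroupOf Cq)),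
      IsHaarMeasure ν' ∧ ν'.IsMulRightInvariant ∧ IsHaarMeasure ρ' ∧ ρ'.IsInvInvariant ∧ SFinite ρ' ∧
      ν = Measure.map (quaternionGlTwoCentralizerAdelicEquiv K D γ' γ hD hγ ht hn) ν' ∧
      ρ = Measure.map (subgroupCongrHomeomorph
        (quaternionGlTwoCentralizerAdelicEquiv K D γ' γ hD hγ ht hn).toMulEquiv
        (((GD).quotientSubgroup ⊓ Cq).subgroupOf Cq) (((G2).quotientSubgroup ⊓ Cg).subgroupOf Cg)
        (quaternionGlTwoCentralizerAdelicEquiv_mem_iff K D γ' γ hD hγ ht hn)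
        (quaternionGlTwoCentralizerAdelicEquiv K D γ' γ hD hγ ht hn).continuous
        (quaternionGlTwoCentralizerAdelicEquiv K D γ' γ hD hγ ht hn).symm.continuous) ρ' := by
  set f := quaternionGlTwoCentralizerAdelicEquiv K D γ' γ hD hγ ht hn with hf
  set fH := subgroupCongrHomeomorph f.toMulEquiv
    (((GD).quotientSubgroup ⊓ Cq).subgroupOf Cq) (((G2).quotientSubgroup ⊓ Cg).subgroupOf Cg)
    (quaternionGlTwoCentralizerAdelicEquiv_mem_iff K D γ' γ hD hγ ht hn) f.continuous f.symm.continuous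
    with hfH
  -- the multiplicative structure of `fH`
  set fHm : ↥(((GD).quotientSubgroup ⊓ Cq).subgroupOf Cq) ≃* ↥(((G2).quotientSubgroup ⊓ Cg).subgroupOf Cg) :=
    { fH.toEquiv with
      map_mul' := fun x y => Subtype.ext (map_mul f.toMulEquiv (x : Cq) y) }
    with hfHm
  refine ⟨Measure.map f.symm ν, Measure.map fHm.symm ρ, inferInstance,
    isMulRightInvariant_map_mulEquiv f.symm.toMulEquiv f.symm.continuous.measurable
      f.continuous.measurable ν,
    MulEquiv.isHaarMeasure_map ρ fHm.symm fH.symm.continuous fH.continuous,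
    isInvInvariant_map_mulEquiv fHm.symm fH.symm.continuous.measurable ρ, inferInstance, ?_, ?_⟩
  · exact (f.toHomeomorph.toMeasurableEquiv.map_map_symm (ν := ν)).symm
  · exact (fH.toMeasurableEquiv.map_map_symm (ν := ρ)).symm

/-- **The hypotheses of `quaternion_glTwo_volumeFactor_eq` hold**: local compactness, the
Hausdorff property and second countability of `GL₂(𝔸_K)` and `D_𝔸ˣ`, closedness of `ℝ_{>0} GL₂(K)`,
`ℝ_{>0} Dˣ` and of the two centralisers (`glTwo_torus_volume_hypotheses`, `units_adelic_topology`,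
`isClosed_quotientSubgroup_units`, `isClosed_centralizer_singleton`). [folklore] -/
theorem quaternion_glTwo_volumeFactor_hypotheses :
    LocallyCompactSpace (G2).Adelic ∧ T2Space (G2).Adelic ∧ SecondCountableTopology (G2).Adelic ∧
      IsClosed ((G2).quotientSubgroup : Set (G2).Adelic) ∧
      IsClosed ((Cg : Subgroup (G2).Adelic) : Set (G2).Adelic) ∧
      LocallyCompactSpace (GD).Adelic ∧ T2Space (GD).Adelic ∧ SecondCountableTopology (GD).Adelic ∧
      IsClosed ((GD).quotientSubgroup : Set (GD).Adelic) ∧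
      IsClosed ((Cq : Subgroup (GD).Adelic) : Set (GD).Adelic) := by
  obtain ⟨h1, h2, h3, h4, h5, -, -, -, -⟩ := glTwo_torus_volume_hypotheses K γ
  obtain ⟨i₁, i₂, i₃⟩ := units_adelic_topology K D
  haveI : T2Space (GD).Adelic := i₂
  haveI : Nontrivial D := Module.nontrivial_of_finrank_pos (R := K)
    (by rw [IsQuaternionAlgebra.finrank_eq_four (K := K) (D := D)]; omega)
  exact ⟨h2, h3, h4, h1, h5, i₁, i₂, i₃, AdelicGroupData.isClosed_quotientSubgroup_units K D,
    isClosed_centralizer_singleton _⟩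

end Comparison

end Literature.NumberTheory.Automorphic
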